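import Mathlib
import Summits.MatrixMultiplication.MatrixMultiplication.Theses.FidelityWitnesses
import Literature.Computability.AlgebraicComplexity.MatMulRankLowerBoundsProofs
import Literature.Computability.AlgebraicComplexity.AlderStrassen
import Literature.Computability.AlgebraicComplexity.AsymptoticRankZariskiClosedProofs
import Summits.MatrixMultiplication.MatrixMultiplication.Theorems.FidelityWitnessesSevenEighthsLawDistance

/-!
# `FidelityWitnesses.SixEighthsAtFive` (stmt-MatrixMultiplication-14040) — effective bound at `(2,5)`, I: the bounded Koszul map

Support file for the item `SixEighthsAtFive` (`M(2,5) ≤ 6`: `‖Σ S·⟨2,2,2⟩‖² ≤ 6 Σ‖S‖²` for every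
tensor `S` of rank `≤ 5` in the `2 × 2` format).  The sharp constant `6` is open; the tree so far has
only the INEFFECTIVE gap (`FidelityGapTwoSix`, by compactness from `R̲(⟨2,2,2⟩) = 7`).  This file proves,
sorry-free (with its sequel `…EffectiveBound.lean`, which has the theorems
`sixEighthsAtFive_dist_sq_ge_quarter` : `Σ |⟨2,2,2⟩ − S|² ≥ 1/4` and `sixEighthsAtFive_effective` :
`‖Σ S·⟨2,2,2⟩‖² ≤ (31/4) Σ‖S‖²` for `tensorRank S ≤ 5`, i.e. `M(2,5) ≤ 7.75`), the first effective constant.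
THIS FILE: the row formula of a `p = 1` Koszul flattening, the Pauli projection, the block rows for a
general tensor, and the boundedness `Σ_r ‖(K_Φ(t) z)_r‖² ≤ 4 (Σ|t|²)(Σ|z|²)` (step 3 below).

Method: a QUANTITATIVE Koszul flattening (Landsberg–Ottaviani) = the witness paradigm of the route one
rung above the plain flattening (`FlatteningWitness`).  Let `K_Φ = koszulFlattening 1 Φ` be the
`p = 1` Koszul flattening after the Pauli projection `Φ : ℂ^{2×2} → ℂ³`, `X ↦ (x₀₀+x₁₁, x₀₁+x₁₀, x₀₀−x₁₁)`
(a `12 × 12` matrix, linear in the tensor).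
1. `rank K_Φ(S) ≤ C(2,1)·5 = 10 < 12` for `R(S) ≤ 5` (tree: `rank_koszulFlattening_sum_triad_le`), so
   `K_Φ(S) z = 0` for some `z ≠ 0` (rank–nullity);
2. `‖K_Φ(⟨2,2,2⟩) z‖² ≥ ‖z‖²` — an exact sum-of-squares identity (`K†K = 1 + 3P`: the six block rows
   are `b − a, c − b, c + a` on two triples of coordinates, and `|b−a|²+|c−b|²+|c+a|² = |a|²+|b|²+|c|²+|a−b+c|²`);
3. `‖K_Φ(D) z‖² ≤ 4 ‖D‖² ‖z‖²` for every tensor `D` (Cauchy–Schwarz row by row; `‖Φ‖² ≤ 2`);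
4. with `D = ⟨2,2,2⟩ − S`: `‖z‖² ≤ ‖K_Φ(⟨2,2,2⟩) z‖² = ‖K_Φ(D) z‖² ≤ 4‖D‖²‖z‖²`, whence `‖D‖² ≥ 1/4`;
5. the rank-`≤ 5` tensors form a cone, so the distance bound polarises to the fidelity bound
   (as in `SevenEighthsLaw.sevenEighthsLaw_iff_unitBall`).

No new definitions (the projection is a local notation for an explicit `Matrix.mulVecLin`).
-/

set_option linter.dupNamespace false

namespace Summit.MatrixMultiplication.MatrixMultiplication.Theorems

open scoped BigOperators ComplexConjugate
open Matrix
open Literature.Computability.AlgebraicComplexity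

/-- The index type `Fin 2 × Fin 2` of `2 × 2` matrices. -/
local notation "P2" => Fin 2 × Fin 2

set_option quotPrecheck false in
/-- The `3 × 4` Pauli coordinate matrix (rows `I`, `σₓ`, `σ_z`): `Φ X = (x₀₀+x₁₁, x₀₁+x₁₀, x₀₀−x₁₁)`. -/
local notation "pauliMat" => (Matrix.of fun (j : Fin (2 * 1 + 1)) (a : Fin 2 × Fin 2) =>
    if j = 0 then (if a.1 = a.2 then (1 : ℂ) else 0)
    else if j = 1 then (if a.1 = a.2 then (0 : ℂ) else 1)
    else (if a.1 = a.2 then (if a.1 = 0 then (1 : ℂ) else -1) else 0))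

set_option quotPrecheck false in
/-- The Pauli projection `ℂ^{2×2} → ℂ³` as a linear map. -/
local notation "ΦP" => Matrix.mulVecLin pauliMat

set_option quotPrecheck false in
/-- The `p = 1` Koszul flattening after the Pauli projection (a `12 × 12` matrix, linear in the tensor). -/
local notation "KP" => koszulFlattening 1 ΦP

set_option quotPrecheck false in
/-- `⟨2,2,2⟩` over `ℂ`. -/
local notation "TT" => (matMulTensor ℂ 2 2 2)

/-- The column blocks `{0}, {1}, {2}` (`PSub 3 1`). -/
local notation "S0" => (⟨{0}, by decide⟩ : PSub (2 * 1 + 1) 1)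
local notation "S1" => (⟨{1}, by decide⟩ : PSub (2 * 1 + 1) 1)
local notation "S2" => (⟨{2}, by decide⟩ : PSub (2 * 1 + 1) 1)
/-- The row blocks `{0,1}, {0,2}, {1,2}` (`PSub 3 2`). -/
local notation "T01" => (⟨{0, 1}, by decide⟩ : PSub (2 * 1 + 1) (1 + 1))
local notation "T02" => (⟨{0, 2}, by decide⟩ : PSub (2 * 1 + 1) (1 + 1))
local notation "T12" => (⟨{1, 2}, by decide⟩ : PSub (2 * 1 + 1) (1 + 1))

/-! ## The row formula of a `p = 1` Koszul flattening -/

/-- Row `(T, c)` of `K_Φ(t) z`: `∑_{j ∈ T} ε(T∖j, j) ∑_b Φ(t(·, b, c))_j z_{(T∖j, b)}`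
(the analogue of the tree's `matMulKoszulMatrix_mulVec` for a general tensor). [folklore] -/
theorem effective_koszulFlattening_mulVec {K : Type*} [CommRing K] (p : ℕ) {ι κ μ : Type*}
    [Fintype κ] (Φ : (ι → K) →ₗ[K] (Fin (2 * p + 1) → K)) (t : ι → κ → μ → K)
    (z : PSub (2 * p + 1) p × κ → K) (T : PSub (2 * p + 1) (p + 1)) (c : μ) :
    (koszulFlattening p Φ t *ᵥ z) (T, c) =
      ∑ j ∈ T.1, (koszulSign (T.1.erase j) j : K) *
        ∑ b, Φ (fun a => t a b c) j * extendPSub z (T.1.erase j) b := by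
  rw [Matrix.mulVec, dotProduct, Fintype.sum_prod_type]
  simp only [koszulFlattening_apply, wedgeMatrix_apply, Finset.sum_mul]
  have : ∀ S : PSub (2 * p + 1) p,
      (∑ b, ∑ j, (if j ∉ S.1 ∧ T.1 = insert j S.1
        then (koszulSign S.1 j : K) * Φ (fun a => t a b c) j else 0) * z (S, b)) =
      ∑ j, (if j ∉ S.1 ∧ T.1 = insert j S.1 then
        (koszulSign S.1 j : K) * ∑ b, Φ (fun a => t a b c) j * extendPSub z S.1 b else 0) := by
    intro S
    rw [Finset.sum_comm]
    refine Finset.sum_congr rfl fun j _ => ?_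
    split_ifs with h
    · rw [Finset.mul_sum]
      refine Finset.sum_congr rfl fun b _ => ?_
      rw [extendPSub_val]; ring
    · simp
  simp only [this]
  exact sum_PSub_wedge T (fun S j => (koszulSign S j : K) *
    ∑ b, Φ (fun a => t a b c) j * extendPSub z S b)

/-! ## The Pauli projection: coordinates and norm bound -/

/-- `Φ(e_a)_j = pauliMat j a`. [folklore] -/
theorem effective_pauli_single (a : P2) (j : Fin (2 * 1 + 1)) :
    (ΦP) (Pi.single a 1) j = (pauliMat) j a := by
  rw [Matrix.mulVecLin_apply, Matrix.mulVec_single_one]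
  rfl

/-- Coordinate `0` of `Φ x` is `x₀₀ + x₁₁`. [folklore] -/
theorem effective_pauli_apply_zero (x : P2 → ℂ) : (ΦP) x 0 = x (0, 0) + x (1, 1) := by
  rw [Matrix.mulVecLin_apply, Matrix.mulVec, dotProduct, Fintype.sum_prod_type]
  simp [Fin.sum_univ_two, Matrix.of_apply]

/-- Coordinate `1` of `Φ x` is `x₀₁ + x₁₀`. [folklore] -/
theorem effective_pauli_apply_one (x : P2 → ℂ) : (ΦP) x 1 = x (0, 1) + x (1, 0) := by
  rw [Matrix.mulVecLin_apply, Matrix.mulVec, dotProduct, Fintype.sum_prod_type]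
  simp [Fin.sum_univ_two, Matrix.of_apply]

/-- Coordinate `2` of `Φ x` is `x₀₀ − x₁₁`. [folklore] -/
theorem effective_pauli_apply_two (x : P2 → ℂ) : (ΦP) x 2 = x (0, 0) - x (1, 1) := by
  rw [Matrix.mulVecLin_apply, Matrix.mulVec, dotProduct, Fintype.sum_prod_type]
  have h2 : (2 : Fin (2 * 1 + 1)) ≠ 0 := by decide
  have h2' : (2 : Fin (2 * 1 + 1)) ≠ 1 := by decide
  simp [Fin.sum_univ_two, Matrix.of_apply, h2, h2']
  ring

/-- `‖Φ x‖² ≤ 2 ‖x‖²`. [folklore] -/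
theorem effective_pauli_norm_sq_le (x : P2 → ℂ) :
    (∑ j, ‖(ΦP) x j‖ ^ 2) ≤ 2 * ∑ a, ‖x a‖ ^ 2 := by
  rw [Fin.sum_univ_three]
  rw [show ((0 : Fin 3)) = (0 : Fin (2 * 1 + 1)) from rfl,
    show ((1 : Fin 3)) = (1 : Fin (2 * 1 + 1)) from rfl,
    show ((2 : Fin 3)) = (2 : Fin (2 * 1 + 1)) from rfl,
    effective_pauli_apply_zero, effective_pauli_apply_one, effective_pauli_apply_two]
  rw [Fintype.sum_prod_type]
  simp only [Fin.sum_univ_two]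
  have hpol : ∀ p q : ℂ, ‖p + q‖ ^ 2 + ‖p - q‖ ^ 2 = 2 * ‖p‖ ^ 2 + 2 * ‖q‖ ^ 2 := fun p q => by
    simp only [Complex.sq_norm, Complex.normSq_add, Complex.normSq_sub]; ring
  have h1 := hpol (x (0, 0)) (x (1, 1))
  have h2 := hpol (x (0, 1)) (x (1, 0))
  nlinarith [h1, h2, sq_nonneg ‖x (0, 1) - x (1, 0)‖]


/-- The two-element subsets of `Fin 3`. [folklore] -/
theorem effective_PSub_two_cases (S : Finset (Fin (2 * 1 + 1))) (h : S.card = 1 + 1) :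
    S = {0, 1} ∨ S = {0, 2} ∨ S = {1, 2} := by
  revert S; decide

/-- The one-element subsets of `Fin 3`. [folklore] -/
theorem effective_PSub_one_cases (S : Finset (Fin (2 * 1 + 1))) (h : S.card = 1) :
    S = {0} ∨ S = {1} ∨ S = {2} := by
  revert S; decide

/-- A sum over `PSub 3 2` is the sum over the three pairs. [folklore] -/
theorem effective_sum_PSub_two {M : Type*} [AddCommMonoid M] (f : PSub (2 * 1 + 1) (1 + 1) → M) :
    (∑ T, f T) = f T01 + f T02 + f T12 := by
  have hu : (Finset.univ : Finset (PSub (2 * 1 + 1) (1 + 1))) = {T01, T02, T12} := by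
    ext T
    simp only [Finset.mem_univ, Finset.mem_insert, Finset.mem_singleton, true_iff]
    rcases effective_PSub_two_cases T.1 T.2 with h | h | h
    · left; exact Subtype.ext h
    · right; left; exact Subtype.ext h
    · right; right; exact Subtype.ext h
  rw [hu, Finset.sum_insert (by decide), Finset.sum_insert (by decide), Finset.sum_singleton]
  abel

/-- A sum over `PSub 3 1` is the sum over the three singletons. [folklore] -/
theorem effective_sum_PSub_one {M : Type*} [AddCommMonoid M] (f : PSub (2 * 1 + 1) 1 → M) :
    (∑ S, f S) = f S0 + f S1 + f S2 := by
  have hu : (Finset.univ : Finset (PSub (2 * 1 + 1) 1)) = {S0, S1, S2} := by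
    ext S
    simp only [Finset.mem_univ, Finset.mem_insert, Finset.mem_singleton, true_iff]
    rcases effective_PSub_one_cases S.1 S.2 with h | h | h
    · left; exact Subtype.ext h
    · right; left; exact Subtype.ext h
    · right; right; exact Subtype.ext h
  rw [hu, Finset.sum_insert (by decide), Finset.sum_insert (by decide), Finset.sum_singleton]
  abel

/-! ## The upper bound `‖K_Φ(D) z‖² ≤ 4 ‖D‖² ‖z‖²` -/

/-- Cauchy–Schwarz for a finite complex sum of products. [folklore] -/
theorem effective_cs {ι : Type*} [Fintype ι] (u v : ι → ℂ) :
    ‖∑ b, u b * v b‖ ^ 2 ≤ (∑ b, ‖u b‖ ^ 2) * ∑ b, ‖v b‖ ^ 2 := by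
  have h1 : ‖∑ b, u b * v b‖ ≤ ∑ b, ‖u b‖ * ‖v b‖ :=
    (norm_sum_le _ _).trans (le_of_eq (Finset.sum_congr rfl fun b _ => norm_mul _ _))
  have h2 : (∑ b, ‖u b‖ * ‖v b‖) ^ 2 ≤ (∑ b, ‖u b‖ ^ 2) * ∑ b, ‖v b‖ ^ 2 :=
    Finset.sum_mul_sq_le_sq_mul_sq _ _ _
  exact (pow_le_pow_left₀ (norm_nonneg _) h1 2).trans h2

/-- Row `({0,1}, c)` of `K_Φ(t) z` for a general tensor: `A₀(z_{{1}}) − A₁(z_{{0}})`. [folklore] -/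
theorem effective_row01_gen (t : P2 → P2 → P2 → ℂ) (z : PSub (2 * 1 + 1) 1 × P2 → ℂ) (c : P2) :
    (KP t *ᵥ z) (T01, c) =
      (∑ b, (ΦP) (fun a => t a b c) 0 * z (S1, b)) - ∑ b, (ΦP) (fun a => t a b c) 1 * z (S0, b) := by
  rw [effective_koszulFlattening_mulVec]
  dsimp only
  have e0 : (({0, 1} : Finset (Fin (2 * 1 + 1))).erase 0) = {1} := by decide
  have e1 : (({0, 1} : Finset (Fin (2 * 1 + 1))).erase 1) = {0} := by decide
  have s0 : koszulSign ({1} : Finset (Fin (2 * 1 + 1))) 0 = 1 := by decide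
  have s1 : koszulSign ({0} : Finset (Fin (2 * 1 + 1))) 1 = -1 := by decide
  rw [Finset.sum_pair (by decide), e0, e1, s0, s1]
  have h1 : ∀ b : P2, extendPSub z ({1} : Finset (Fin (2 * 1 + 1))) b = z (S1, b) :=
    fun b => extendPSub_of_card z (by decide) b
  have h0 : ∀ b : P2, extendPSub z ({0} : Finset (Fin (2 * 1 + 1))) b = z (S0, b) :=
    fun b => extendPSub_of_card z (by decide) b
  simp only [h1, h0]
  push_cast
  ring

/-- Row `({0,2}, c)`: `A₀(z_{{2}}) − A₂(z_{{0}})`. [folklore] -/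
theorem effective_row02_gen (t : P2 → P2 → P2 → ℂ) (z : PSub (2 * 1 + 1) 1 × P2 → ℂ) (c : P2) :
    (KP t *ᵥ z) (T02, c) =
      (∑ b, (ΦP) (fun a => t a b c) 0 * z (S2, b)) - ∑ b, (ΦP) (fun a => t a b c) 2 * z (S0, b) := by
  rw [effective_koszulFlattening_mulVec]
  dsimp only
  have e0 : (({0, 2} : Finset (Fin (2 * 1 + 1))).erase 0) = {2} := by decide
  have e1 : (({0, 2} : Finset (Fin (2 * 1 + 1))).erase 2) = {0} := by decide
  have s0 : koszulSign ({2} : Finset (Fin (2 * 1 + 1))) 0 = 1 := by decide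
  have s1 : koszulSign ({0} : Finset (Fin (2 * 1 + 1))) 2 = -1 := by decide
  rw [Finset.sum_pair (by decide), e0, e1, s0, s1]
  have h1 : ∀ b : P2, extendPSub z ({2} : Finset (Fin (2 * 1 + 1))) b = z (S2, b) :=
    fun b => extendPSub_of_card z (by decide) b
  have h0 : ∀ b : P2, extendPSub z ({0} : Finset (Fin (2 * 1 + 1))) b = z (S0, b) :=
    fun b => extendPSub_of_card z (by decide) b
  simp only [h1, h0]
  push_cast
  ring

/-- Row `({1,2}, c)`: `A₁(z_{{2}}) − A₂(z_{{1}})`. [folklore] -/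
theorem effective_row12_gen (t : P2 → P2 → P2 → ℂ) (z : PSub (2 * 1 + 1) 1 × P2 → ℂ) (c : P2) :
    (KP t *ᵥ z) (T12, c) =
      (∑ b, (ΦP) (fun a => t a b c) 1 * z (S2, b)) - ∑ b, (ΦP) (fun a => t a b c) 2 * z (S1, b) := by
  rw [effective_koszulFlattening_mulVec]
  dsimp only
  have e0 : (({1, 2} : Finset (Fin (2 * 1 + 1))).erase 1) = {2} := by decide
  have e1 : (({1, 2} : Finset (Fin (2 * 1 + 1))).erase 2) = {1} := by decide
  have s0 : koszulSign ({2} : Finset (Fin (2 * 1 + 1))) 1 = 1 := by decide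
  have s1 : koszulSign ({1} : Finset (Fin (2 * 1 + 1))) 2 = -1 := by decide
  rw [Finset.sum_pair (by decide), e0, e1, s0, s1]
  have h1 : ∀ b : P2, extendPSub z ({2} : Finset (Fin (2 * 1 + 1))) b = z (S2, b) :=
    fun b => extendPSub_of_card z (by decide) b
  have h0 : ∀ b : P2, extendPSub z ({1} : Finset (Fin (2 * 1 + 1))) b = z (S1, b) :=
    fun b => extendPSub_of_card z (by decide) b
  simp only [h1, h0]
  push_cast
  ring

/-- **The Koszul flattening is a bounded map**: `Σ_r ‖(K_Φ(t) z)_r‖² ≤ 4 (Σ|t|²)(Σ|z|²)` for every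
tensor `t` (Cauchy–Schwarz on each of the six block rows, then `‖Φ x‖² ≤ 2‖x‖²`). [folklore] -/
theorem effective_upper_bound (t : P2 → P2 → P2 → ℂ) (z : PSub (2 * 1 + 1) 1 × P2 → ℂ) :
    (∑ r, ‖(KP t *ᵥ z) r‖ ^ 2) ≤
      4 * (∑ a, ∑ b, ∑ c, ‖t a b c‖ ^ 2) * ∑ q, ‖z q‖ ^ 2 := by
  -- abbreviations
  set α : Fin (2 * 1 + 1) → P2 → ℝ := fun j c => ∑ b, ‖(ΦP) (fun a => t a b c) j‖ ^ 2 with hα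
  set ζ : PSub (2 * 1 + 1) 1 → ℝ := fun S => ∑ b, ‖z (S, b)‖ ^ 2 with hζ
  have hα0 : ∀ j c, 0 ≤ α j c := fun j c => by positivity
  have hζ0 : ∀ S, 0 ≤ ζ S := fun S => by positivity
  have hZ : (∑ q, ‖z q‖ ^ 2) = ζ S0 + ζ S1 + ζ S2 := by
    rw [Fintype.sum_prod_type, effective_sum_PSub_one]
  -- Cauchy–Schwarz on the six blocks
  have cs : ∀ (j : Fin (2 * 1 + 1)) (S : PSub (2 * 1 + 1) 1) (c : P2),
      ‖∑ b, (ΦP) (fun a => t a b c) j * z (S, b)‖ ^ 2 ≤ α j c * ζ S :=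
    fun j S c => effective_cs _ _
  -- per-row bounds (`‖p − q‖² ≤ 2‖p‖² + 2‖q‖²`)
  have hsub : ∀ p q : ℂ, ‖p - q‖ ^ 2 ≤ 2 * ‖p‖ ^ 2 + 2 * ‖q‖ ^ 2 := fun p q => by
    have hpol : ‖p + q‖ ^ 2 + ‖p - q‖ ^ 2 = 2 * ‖p‖ ^ 2 + 2 * ‖q‖ ^ 2 := by
      simp only [Complex.sq_norm, Complex.normSq_add, Complex.normSq_sub]; ring
    nlinarith [sq_nonneg ‖p + q‖]
  have r01 : ∀ c, ‖(KP t *ᵥ z) (T01, c)‖ ^ 2 ≤ 2 * (α 0 c * ζ S1) + 2 * (α 1 c * ζ S0) := by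
    intro c
    rw [effective_row01_gen]
    refine (hsub _ _).trans ?_
    linarith [cs 0 S1 c, cs 1 S0 c]
  have r02 : ∀ c, ‖(KP t *ᵥ z) (T02, c)‖ ^ 2 ≤ 2 * (α 0 c * ζ S2) + 2 * (α 2 c * ζ S0) := by
    intro c
    rw [effective_row02_gen]
    refine (hsub _ _).trans ?_
    linarith [cs 0 S2 c, cs 2 S0 c]
  have r12 : ∀ c, ‖(KP t *ᵥ z) (T12, c)‖ ^ 2 ≤ 2 * (α 1 c * ζ S2) + 2 * (α 2 c * ζ S1) := by
    intro c
    rw [effective_row12_gen]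
    refine (hsub _ _).trans ?_
    linarith [cs 1 S2 c, cs 2 S1 c]
  -- the per-`c` bound
  have perc : ∀ c, ‖(KP t *ᵥ z) (T01, c)‖ ^ 2 + ‖(KP t *ᵥ z) (T02, c)‖ ^ 2 +
      ‖(KP t *ᵥ z) (T12, c)‖ ^ 2 ≤ 2 * (α 0 c + α 1 c + α 2 c) * (ζ S0 + ζ S1 + ζ S2) := by
    intro c
    have := r01 c; have := r02 c; have := r12 c
    nlinarith [hα0 0 c, hα0 1 c, hα0 2 c, hζ0 S0, hζ0 S1, hζ0 S2,
      mul_nonneg (hα0 0 c) (hζ0 S0), mul_nonneg (hα0 1 c) (hζ0 S1), mul_nonneg (hα0 2 c) (hζ0 S2)]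
  -- the Pauli norm bound, summed
  have hΦ : ∀ c, α 0 c + α 1 c + α 2 c ≤ 2 * ∑ b, ∑ a, ‖t a b c‖ ^ 2 := by
    intro c
    have : α 0 c + α 1 c + α 2 c = ∑ b, ∑ j, ‖(ΦP) (fun a => t a b c) j‖ ^ 2 := by
      simp only [hα]
      rw [← Finset.sum_add_distrib, ← Finset.sum_add_distrib]
      refine Finset.sum_congr rfl fun b _ => ?_
      rw [Fin.sum_univ_three]
    rw [this, Finset.mul_sum]
    exact Finset.sum_le_sum fun b _ => effective_pauli_norm_sq_le _
  -- assemble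
  have hsum : (∑ r, ‖(KP t *ᵥ z) r‖ ^ 2) =
      ∑ c, (‖(KP t *ᵥ z) (T01, c)‖ ^ 2 + ‖(KP t *ᵥ z) (T02, c)‖ ^ 2 +
        ‖(KP t *ᵥ z) (T12, c)‖ ^ 2) := by
    rw [Fintype.sum_prod_type, effective_sum_PSub_two, Finset.sum_add_distrib, Finset.sum_add_distrib]
  rw [hsum, hZ]
  have hT : (∑ a, ∑ b, ∑ c, ‖t a b c‖ ^ 2) = ∑ c, ∑ b, ∑ a, ‖t a b c‖ ^ 2 := by
    calc (∑ a, ∑ b, ∑ c, ‖t a b c‖ ^ 2) = ∑ a, ∑ c, ∑ b, ‖t a b c‖ ^ 2 :=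
          Finset.sum_congr rfl fun a _ => Finset.sum_comm
      _ = ∑ c, ∑ a, ∑ b, ‖t a b c‖ ^ 2 := Finset.sum_comm
      _ = ∑ c, ∑ b, ∑ a, ‖t a b c‖ ^ 2 := Finset.sum_congr rfl fun c _ => Finset.sum_comm
  have hA : (∑ c, (α 0 c + α 1 c + α 2 c)) ≤ 2 * ∑ a, ∑ b, ∑ c, ‖t a b c‖ ^ 2 := by
    rw [hT, Finset.mul_sum]
    exact Finset.sum_le_sum fun c _ => hΦ c
  have hZ0 : 0 ≤ ζ S0 + ζ S1 + ζ S2 := by linarith [hζ0 S0, hζ0 S1, hζ0 S2]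
  calc (∑ c, (‖(KP t *ᵥ z) (T01, c)‖ ^ 2 + ‖(KP t *ᵥ z) (T02, c)‖ ^ 2 +
          ‖(KP t *ᵥ z) (T12, c)‖ ^ 2))
      ≤ ∑ c, 2 * (α 0 c + α 1 c + α 2 c) * (ζ S0 + ζ S1 + ζ S2) :=
        Finset.sum_le_sum fun c _ => perc c
    _ = 2 * (∑ c, (α 0 c + α 1 c + α 2 c)) * (ζ S0 + ζ S1 + ζ S2) := by
        rw [Finset.mul_sum, Finset.sum_mul]
    _ ≤ 2 * (2 * ∑ a, ∑ b, ∑ c, ‖t a b c‖ ^ 2) * (ζ S0 + ζ S1 + ζ S2) := by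
        nlinarith [hA, hZ0]
    _ = 4 * (∑ a, ∑ b, ∑ c, ‖t a b c‖ ^ 2) * (ζ S0 + ζ S1 + ζ S2) := by ring

end Summit.MatrixMultiplication.MatrixMultiplication.Theorems
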